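import Summits.BirchSwinnertonDyer.BirchSwinnertonDyer.Theorems.SignedLowerHalvesSmallImageLowerHalfBothSignsRttD2SeqLocalDualO
import Summits.BirchSwinnertonDyer.BirchSwinnertonDyer.Theorems.SignedLowerHalvesSmallImageLowerHalfBothSignsRttCharRoadE2JunctionShaSocket
import Literature.NumberTheory.EllipticCurves.IwasawaSelmerDualFunctorialityProofs
import HarnessLib

/-!
# Route `SignedLowerHalves`, crux L `SmallImageLowerHalfBothSigns` (stmt-BirchSwinnertonDyer-23599), line `rtt_w3` v22 — stub S3 `stub_junctionLambda_ns`
# (row J4′, the global λ-inequality): THE STRICT SELMER DUAL `Y′ = Sel^{ε,S₀}_{str at Σ}(K_∞, M)^∨` — the object through which S3 SPLITS into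
# S3α `λ(H²₂/T₂) ≤ λ(Y′)` (Ш-half) and S3β `λ(Λ_𝒪/(E)) + λ(Y′) ≤ λ(coker gX) + λ(I.H/B′)` (Poitou–Tate four-term half) — with its forced `Λ`-structure,
# the `Λ`-linear restriction `coker gX ↠ Y′`, and ★ `λ(Y′) ≤ λ(coker gX)`

Stub hand `bsd-inputs-lambda-p1` g0 under LEAD `cruxlead-stmt-BirchSwinnertonDyer-23599` g12 (cell `bsd-ssimc`); helper `--supports stmt-BirchSwinnertonDyer-23599`.
DEFINITIONS WITH BODIES (`locAt`, `strictSelmer`, `conjStrict`, `strictDualModule`, `resStrictHom`, `resStrictLinearMap`) + THEOREMS; no named fact, no instance,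
no `sorry`. HONEST FRAMING: S3 (= the Iwasawa-level Poitou–Tate inequality `λ(H²₂/T₂) + λ(Λ_𝒪/(E)) ≤ λ(Dψ.X/range gX) + λ(I.H/B′)`) is NOT proved here and is
proved for NO curve; this file only builds the definite kernel object `Y′` of the LEAD's contract (BRIEF-E2 rev 6 §2 J4′: "`π : (Dψ.X ⧸ range gX) →ₗ Y′` onto,
`Y′ := (Sel^{str at S₀K, str at v}(K_∞, A))^∨`") and the elementary half of the four-term bookkeeping (`Y ↠ Y′`, hence `λ(Y′) ≤ λ(Y)`), so that the two research
halves S3α/S3β can be registered as BY-NAME-closable statements about `Y′`.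

* §1 `locAt w` — the localisation `H¹(Gal(K̄/K_∞), M) → H¹(Gal(K̄_w/K_∞·K_w), M)` at ANY place `w` for the canonical restricted action `localAction` (= `locH1` with
  the pin `rfl`); ★ `strictSelmer S₁ ≤ Sel^{ε,S₀}_R(K_∞, M)` — the classes all of whose localisations `loc_w ∘ conj_σ` (`w ∈ Σ`, `σ ∈ Γ_K`: every prime of `K_∞`
  above `Σ`) vanish; `strictSelmer_le_strictAt` (for `v ∈ Σ`), stability under every `conj_τ` and under the scalars.
* §2 `conjStrict`, `isLocNil_conjStrict_sub_one`, the forced `Λ = ℤ_p⟦T⟧`-structure `strictDualModule` on `Y′ := Hom(strictSelmer Σ, ℚ/ℤ)` (`T ↦ conj_γ − 1`).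
* §3 `resStrictHom D : Dψ.X → Y′` (`x ↦ toDual x|_{Sel_str}`, the tree's `IwasawaDual.dualHom`): `Λ`-linear (`resStrictLinearMap`, forcing lemma), SURJECTIVE
  (`ℚ/ℤ` injective), and it KILLS `range gX` (`gX = loc_v^∨`, `Sel_str ≤ ker loc_v`).
* §4 ★ `lambdaInvariant_strictDual_le_coker`: `λ(Y′) ≤ λ(Dψ.X ⧸ range gX)` for `Dψ.X` f.g. torsion (the surjection `coker gX ↠ Y′`, `lambdaInvariant_le_of_surjective'`),
  in `Λ`-currency (`gXLinearMap`) and ★ in the stub's `Λ_𝒪`-currency (`gXLinearMapO`, any pinned `Λ_𝒪`-structures; `Submodule.Quotient.restrictScalarsEquiv`).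
References: [Kobayashi2003] Thm. 7.3 i) (`Sel_0`, the five-term sequence); [Rubin2000] Thm. 1.7.3; [GreenbergLNM1716] §1; [Washington1997] §13.2.
-/

set_option autoImplicit false
set_option linter.dupNamespace false -- D-0017: single-problem summit, the namespace repeats the problem name by design
noncomputable section

open scoped Classical
open NumberField IsDedekindDomain Field

universe u

namespace Summit.BirchSwinnertonDyer.BirchSwinnertonDyer.Theorems.SmallImageRttD2Seq

open Literature.NumberTheory.EllipticCurves Literature.NumberTheory.EllipticCurves.Kobayashi2003
  Literature.NumberTheory.EllipticCurves.GreenbergVatsal2000 Literature.NumberTheory.GaloisRepresentations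
  Summit.BirchSwinnertonDyer.BirchSwinnertonDyer.Theorems.SmallImageCharSignedSelmer

/-! ## §1. Localisation at an arbitrary place and the strict Selmer group -/

section Strict

variable {K : Type u} [Field K] [NumberField K] {p : ℕ} [Fact p.Prime] (κ : ZpExtension K p)
  (M : Type u) [AddCommGroup M] [DistribMulAction (absoluteGaloisGroup K) M] [TopologicalSpace M] [DiscreteTopology M]
  (R : Type*) [Ring R] [Module R M]
  (V : WeierstrassCurve K) (j : V.geomPrimaryTorsion p →+ M) (S₀ : Set (HeightOneSpectrum (𝓞 K))) (ε : ℤˣ)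

/-- **`loc_w : H¹(Gal(K̄/K_∞), M) → H¹(Gal(K̄_w/K_∞·K_w), M)` at ANY place `w`**, for the canonical restricted action `M|_{Γ_{K_w}}` (`localAction` along
`closureEmb K_w`; the pin `σ • m = res_ι σ • m` is `rfl`): the sibling file's `locH1` with that filler. [cite: SerreGaloisCohomology1997, II.§1.1]
[cite: Kobayashi2003, Thm. 7.3 i)] -/
def locAt (w : HeightOneSpectrum (𝓞 K)) :
    letI := localAction (closureEmb (K := K) (w.adicCompletion K)) M
    subgroupH1 κ.kerSubgroup M →+ subgroupH1 (localSubgroupOfEmb κ.kerSubgroup (closureEmb (K := K) (w.adicCompletion K))) M :=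
  letI := localAction (closureEmb (K := K) (w.adicCompletion K)) M
  locH1 κ M w (fun _ _ ↦ rfl)

/-- ★ **The strict Selmer group `Sel^{ε,S₀}_{R, str at Σ}(K_∞, M) ≤ Sel^{ε,S₀}_R(K_∞, M)`**: the saturated signed Selmer classes `s` with
`loc_w (conj_σ s) = 0` for every `w ∈ Σ` and every `σ ∈ Γ_K` — i.e. locally trivial at EVERY prime of `K_∞` above `Σ` (the conjugates `loc_w ∘ conj_σ`
enumerate them). Intended `Σ = S₀K ∪ {v}`: the `S₀K`-strict, `v`-strict ("fine") Selmer group whose Pontryagin dual is the term `Y′` of the compact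
Poitou–Tate five-term sequence `B′ ↪ I.H → Hloc → coker gX ↠ Y′` (BRIEF-E2 rev 6 §2 J4′). [cite: Kobayashi2003, Thm. 7.3 i) (`Sel_0`)] [cite: Rubin2000, Thm. 1.7.3] -/
def strictSelmer (S₁ : Set (HeightOneSpectrum (𝓞 K))) : AddSubgroup (signedTransportSelmerInftySat κ M R V j S₀ ε) :=
  ⨅ (w : HeightOneSpectrum (𝓞 K)) (_ : w ∈ S₁) (σ : absoluteGaloisGroup K),
    (locAt κ M w).ker.comap ((conjH1 κ.kerSubgroup M σ).comp (signedTransportSelmerInftySat κ M R V j S₀ ε).subtype)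

/-- Membership in `strictSelmer`. [cite: Kobayashi2003, Thm. 7.3 i)] -/
theorem mem_strictSelmer_iff (S₁ : Set (HeightOneSpectrum (𝓞 K))) (s : signedTransportSelmerInftySat κ M R V j S₀ ε) :
    s ∈ strictSelmer κ M R V j S₀ ε S₁ ↔
      ∀ w ∈ S₁, ∀ σ : absoluteGaloisGroup K, locAt κ M w (conjH1 κ.kerSubgroup M σ s) = 0 := by
  simp only [strictSelmer, AddSubgroup.mem_iInf, AddSubgroup.mem_comap, AddMonoidHom.mem_ker, AddMonoidHom.comp_apply,
    AddSubgroup.coe_subtype]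

/-- Shrinking `Σ` relaxes the condition. [folklore] -/
theorem strictSelmer_anti {S₁ S₁' : Set (HeightOneSpectrum (𝓞 K))} (h : S₁ ⊆ S₁') :
    strictSelmer κ M R V j S₀ ε S₁' ≤ strictSelmer κ M R V j S₀ ε S₁ := fun s hs ↦
  (mem_strictSelmer_iff κ M R V j S₀ ε S₁ s).2 fun w hw σ ↦ (mem_strictSelmer_iff κ M R V j S₀ ε S₁' s).1 hs w (h hw) σ

/-- ★ **`Sel_{str at Σ} ≤ Sel_{str,v} = ker loc_v`** for `v ∈ Σ` (the conjugate `σ = 1`), `loc_v` taken for the canonical restricted action: the strict dual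
`Y′` is a quotient of `coker gX = Sel_{str,v}^∨`. [cite: Kobayashi2003, Thm. 7.3 i)] -/
theorem strictSelmer_le_strictAt {S₁ : Set (HeightOneSpectrum (𝓞 K))} {v : HeightOneSpectrum (𝓞 K)} (hvS : v ∈ S₁) (hv : (p : 𝓞 K) ∈ v.asIdeal) :
    letI := localAction (closureEmb (K := K) (v.adicCompletion K)) M
    strictSelmer κ M R V j S₀ ε S₁ ≤ strictAt κ M R V j S₀ ε v (fun _ _ ↦ rfl) hv := by
  letI := localAction (closureEmb (K := K) (v.adicCompletion K)) M
  intro s hs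
  have h := (mem_strictSelmer_iff κ M R V j S₀ ε S₁ s).1 hs v hvS 1
  rw [conjH1_one_holds κ.kerSubgroup M, AddMonoidHom.id_apply] at h
  exact (mem_strictAt_iff κ M R V j S₀ ε v (fun _ _ ↦ rfl) hv s).2 h

/-- **`Sel_{str at Σ}` is stable under every conjugation `conj_τ`, `τ ∈ Γ_K`** (`conj_σ ∘ conj_τ = conj_{στ}` permutes the conditions).
[cite: NeukirchSchmidtWingberg2008, I.§5] -/
theorem conjSignedSat_mem_strictSelmer (S₁ : Set (HeightOneSpectrum (𝓞 K))) (τ : absoluteGaloisGroup K)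
    {s : signedTransportSelmerInftySat κ M R V j S₀ ε} (hs : s ∈ strictSelmer κ M R V j S₀ ε S₁) :
    conjSignedSat κ M R V j S₀ ε τ s ∈ strictSelmer κ M R V j S₀ ε S₁ := by
  rw [mem_strictSelmer_iff] at hs ⊢
  intro w hw σ
  have h := hs w hw (σ * τ)
  rw [conjH1_mul_holds κ.kerSubgroup M σ τ, AddMonoidHom.comp_apply] at h
  rw [coe_conjSignedSat_apply]
  exact h

/-- **`Sel_{str at Σ}` is stable under the scalars `R`** (localisation and conjugation commute with `scalarH1`). [cite: EmertonPollackWeston2006, §3.1] -/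
theorem scalarH1_mem_strictSelmer [SMulCommClass (absoluteGaloisGroup K) R M] (S₁ : Set (HeightOneSpectrum (𝓞 K))) (r : R)
    {s : signedTransportSelmerInftySat κ M R V j S₀ ε} (hs : s ∈ strictSelmer κ M R V j S₀ ε S₁) :
    (⟨GreenbergSelmer.scalarH1 κ.kerSubgroup M r s, scalarH1_mem_signedTransportSelmerInftySat κ M R V j S₀ ε r s.2⟩ :
      signedTransportSelmerInftySat κ M R V j S₀ ε) ∈ strictSelmer κ M R V j S₀ ε S₁ := by
  rw [mem_strictSelmer_iff] at hs ⊢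
  intro w hw σ
  letI := localAction (closureEmb (K := K) (w.adicCompletion K)) M
  haveI := smulCommClass_localAction M w (R := R)
  have h1 : conjH1 κ.kerSubgroup M σ (GreenbergSelmer.scalarH1 κ.kerSubgroup M r s) =
      GreenbergSelmer.scalarH1 κ.kerSubgroup M r (conjH1 κ.kerSubgroup M σ s) := by
    rw [← AddMonoidHom.comp_apply, GreenbergSelmer.conjH1_comp_scalarH1, AddMonoidHom.comp_apply]
  have h2 : locH1 κ M w (fun _ _ ↦ rfl) (GreenbergSelmer.scalarH1 κ.kerSubgroup M r (conjH1 κ.kerSubgroup M σ s)) =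
      GreenbergSelmer.scalarH1 _ M r (locH1 κ M w (fun _ _ ↦ rfl) (conjH1 κ.kerSubgroup M σ s)) := by
    rw [← AddMonoidHom.comp_apply, locH1_comp_scalarH1, AddMonoidHom.comp_apply]
  have h0 : locH1 κ M w (fun _ _ ↦ rfl) (conjH1 κ.kerSubgroup M σ s) = 0 := hs w hw σ
  change locH1 κ M w (fun _ _ ↦ rfl) (conjH1 κ.kerSubgroup M σ (GreenbergSelmer.scalarH1 κ.kerSubgroup M r s)) = 0
  rw [h1, h2, h0, map_zero]

end Strict

/-! ## §2. The forced `Λ`-structure on the strict dual `Y′ = Hom(Sel_str, ℚ/ℤ)` -/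

section Dual

variable {K : Type u} [Field K] [NumberField K] {p : ℕ} [Fact p.Prime] (κ : ZpExtension K p)
  (M : Type u) [AddCommGroup M] [DistribMulAction (absoluteGaloisGroup K) M] [TopologicalSpace M] [DiscreteTopology M]
  (R : Type*) [Ring R] [Module R M]
  (V : WeierstrassCurve K) (j : V.geomPrimaryTorsion p →+ M) (S₀ : Set (HeightOneSpectrum (𝓞 K))) (ε : ℤˣ)
  (S₁ : Set (HeightOneSpectrum (𝓞 K)))

/-- `conj_τ` as an endomorphism of `Sel_{str at Σ}` (`conjSignedSat` restricted and corestricted). [cite: GreenbergVatsal2000, §2 p. 17] -/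
def conjStrict (τ : absoluteGaloisGroup K) : AddMonoid.End (strictSelmer κ M R V j S₀ ε S₁) :=
  (((conjSignedSat κ M R V j S₀ ε τ) : signedTransportSelmerInftySat κ M R V j S₀ ε →+ _).restrict (strictSelmer κ M R V j S₀ ε S₁)).codRestrict
    (strictSelmer κ M R V j S₀ ε S₁) fun s ↦ conjSignedSat_mem_strictSelmer κ M R V j S₀ ε S₁ τ s.2

/-- Unfolding `conjStrict` (definitional). [folklore] -/
@[simp] theorem coe_conjStrict_apply (τ : absoluteGaloisGroup K) (s : strictSelmer κ M R V j S₀ ε S₁) :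
    ((conjStrict κ M R V j S₀ ε S₁ τ s : strictSelmer κ M R V j S₀ ε S₁) : signedTransportSelmerInftySat κ M R V j S₀ ε) =
      conjSignedSat κ M R V j S₀ ε τ s := rfl

/-- Powers: `(conjStrict τ)^m s = (conjSignedSat τ)^m s` on underlying classes. [folklore] -/
theorem coe_conjStrict_pow_apply (τ : absoluteGaloisGroup K) (m : ℕ) (s : strictSelmer κ M R V j S₀ ε S₁) :
    ((((conjStrict κ M R V j S₀ ε S₁ τ) ^ m) s : strictSelmer κ M R V j S₀ ε S₁) : signedTransportSelmerInftySat κ M R V j S₀ ε) =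
      ((conjSignedSat κ M R V j S₀ ε τ) ^ m) (s : signedTransportSelmerInftySat κ M R V j S₀ ε) := by
  induction m generalizing s with
  | zero => rfl
  | succ m ih => rw [pow_succ, pow_succ, AddMonoid.End.coe_mul, AddMonoid.End.coe_mul, Function.comp_apply, Function.comp_apply, ih, coe_conjStrict_apply]

/-- `(conjStrict τ − 1) s = (conjSignedSat τ − 1) s` on underlying classes. [folklore] -/
theorem coe_conjStrict_sub_one_apply (τ : absoluteGaloisGroup K) (s : strictSelmer κ M R V j S₀ ε S₁) :
    (((conjStrict κ M R V j S₀ ε S₁ τ - 1) s : strictSelmer κ M R V j S₀ ε S₁) : signedTransportSelmerInftySat κ M R V j S₀ ε) =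
      (conjSignedSat κ M R V j S₀ ε τ - 1) (s : signedTransportSelmerInftySat κ M R V j S₀ ε) := rfl

/-- Powers of `conjStrict τ − 1` on underlying classes. [folklore] -/
theorem coe_conjStrict_sub_one_pow_apply (τ : absoluteGaloisGroup K) (m : ℕ) (s : strictSelmer κ M R V j S₀ ε S₁) :
    ((((conjStrict κ M R V j S₀ ε S₁ τ - 1) ^ m) s : strictSelmer κ M R V j S₀ ε S₁) : signedTransportSelmerInftySat κ M R V j S₀ ε) =
      ((conjSignedSat κ M R V j S₀ ε τ - 1) ^ m) (s : signedTransportSelmerInftySat κ M R V j S₀ ε) := by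
  induction m generalizing s with
  | zero => rfl
  | succ m ih => rw [pow_succ, pow_succ, AddMonoid.End.coe_mul, AddMonoid.End.coe_mul, Function.comp_apply, Function.comp_apply, ih]; rfl

variable {M}

/-- **`T = conj_γ − 1` is locally nilpotent on `Sel_{str at Σ}` and the group is `p`-primary** (inherited from `Sel^{ε,S₀}_R(K_∞, M)`,
`isLocNil_conjSignedSat_sub_one`), for `M` `p`-primary with open stabilisers and `γ` a topological generator. [cite: GreenbergLNM1716, §1 (after Conj. 1.3)] -/
theorem isLocNil_conjStrict_sub_one (htor : ∀ m : M, ∃ k : ℕ, p ^ k • m = 0)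
    (hstab : ∀ m : M, IsOpen (MulAction.stabilizer (absoluteGaloisGroup K) m : Set (absoluteGaloisGroup K)))
    {γ : absoluteGaloisGroup K} (hγ : κ.IsTopGenerator γ) :
    IwasawaDual.IsLocNil p (conjStrict κ M R V j S₀ ε S₁ γ - 1) := by
  have h := isLocNil_conjSignedSat_sub_one κ R V j S₀ ε htor hstab hγ
  refine ⟨fun s ↦ ?_, fun s ↦ ?_⟩
  · obtain ⟨k, hk⟩ := h.torsion (s : signedTransportSelmerInftySat κ M R V j S₀ ε)
    exact ⟨k, Subtype.ext (by rw [AddSubgroupClass.coe_nsmul]; exact hk)⟩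
  · obtain ⟨N, hN⟩ := h.nil (s : signedTransportSelmerInftySat κ M R V j S₀ ε)
    exact ⟨N, Subtype.ext (by rw [coe_conjStrict_sub_one_pow_apply]; exact hN)⟩

/-- **The `Λ = ℤ_p⟦T⟧`-structure on the strict dual `Y′ = Hom(Sel_{str at Σ}, ℚ/ℤ)`**, `T ↦ (x ↦ x ∘ (conj_γ − 1))`, constants through `ℤ_p → ℤ/p^k`
(the tree's `IwasawaDual.IsLocNil.module`; a `def`, activate with `letI`). With it `λ(Y′) = lambdaInvariant p Y′` is the number in S3α/S3β.
[cite: GreenbergLNM1716, §1 (after Conj. 1.3)] [cite: Washington1997, §13.2] -/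
@[reducible] def strictDualModule (htor : ∀ m : M, ∃ k : ℕ, p ^ k • m = 0)
    (hstab : ∀ m : M, IsOpen (MulAction.stabilizer (absoluteGaloisGroup K) m : Set (absoluteGaloisGroup K)))
    {γ : absoluteGaloisGroup K} (hγ : κ.IsTopGenerator γ) :
    Module (IwasawaAlgebra p) (strictSelmer κ M R V j S₀ ε S₁ →+ AddCircle (1 : ℚ)) :=
  (isLocNil_conjStrict_sub_one κ R V j S₀ ε S₁ htor hstab hγ).module

/-- Under `strictDualModule`, `f • y = f ⋆ y` (the canonical finite-sum action; definitional). [folklore] -/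
theorem strictDualModule_smul_eq (htor : ∀ m : M, ∃ k : ℕ, p ^ k • m = 0)
    (hstab : ∀ m : M, IsOpen (MulAction.stabilizer (absoluteGaloisGroup K) m : Set (absoluteGaloisGroup K)))
    {γ : absoluteGaloisGroup K} (hγ : κ.IsTopGenerator γ) (f : IwasawaAlgebra p) (y : strictSelmer κ M R V j S₀ ε S₁ →+ AddCircle (1 : ℚ)) :
    (letI := strictDualModule κ R V j S₀ ε S₁ htor hstab hγ; f • y) = (isLocNil_conjStrict_sub_one κ R V j S₀ ε S₁ htor hstab hγ).smulFun f y :=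
  rfl

end Dual

/-! ## §3. The restriction `Dψ.X → Y′`: `Λ`-linear, onto, killing `range gX` -/

section Restriction

variable {K : Type u} [Field K] [NumberField K] {p : ℕ} [Fact p.Prime] {κ : ZpExtension K p} {γ : absoluteGaloisGroup K}
  {M : Type u} [AddCommGroup M] [DistribMulAction (absoluteGaloisGroup K) M] [TopologicalSpace M] [DiscreteTopology M]
  {R : Type*} [Ring R] [Module R M]
  {V : WeierstrassCurve K} {j : V.geomPrimaryTorsion p →+ M} {S₀ : Set (HeightOneSpectrum (𝓞 K))} {ε : ℤˣ}
  (D : SignedTransportDualDataSat κ γ M R V j S₀ ε) (S₁ : Set (HeightOneSpectrum (𝓞 K)))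

/-- **`res : Dψ.X → Y′ = Hom(Sel_{str at Σ}, ℚ/ℤ)`, `x ↦ toDual x|_{Sel_str}`** — the transpose of the inclusion `Sel_str ≤ Sel` through `Dψ.toDual`
(the tree's `IwasawaDual.dualHom` with `toDual₁ = id`). Its descent to `coker gX` is the surjection `π : coker gX ↠ Y′` of the four-term sequence.
[cite: Washington1997, §13.2] [cite: Rubin2000, Thm. 1.7.3] -/
def resStrictHom : D.X →+ (strictSelmer κ M R V j S₀ ε S₁ →+ AddCircle (1 : ℚ)) :=
  IwasawaDual.dualHom (AddMonoidHom.id _) Function.bijective_id D.toDual (strictSelmer κ M R V j S₀ ε S₁).subtype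

/-- Values of `resStrictHom`: `res x s = toDual x s`. [cite: Washington1997, §13.2] -/
@[simp] theorem resStrictHom_apply (x : D.X) (s : strictSelmer κ M R V j S₀ ε S₁) :
    resStrictHom D S₁ x s = D.toDual x (s : signedTransportSelmerInftySat κ M R V j S₀ ε) :=
  IwasawaDual.toDual_dualHom_apply (AddMonoidHom.id _) Function.bijective_id D.toDual (strictSelmer κ M R V j S₀ ε S₁).subtype x s

/-- **`res` is `Λ`-linear** for the forced structure on `Y′` (both `Λ`-actions are the canonical finite-sum actions read through `toDual`: the LEAD's
`toDual_smul_eq_smulFun` and `rfl`; the inclusion intertwines `conj_γ − 1`; the tree's `IwasawaDual.dualHom_smul`). [cite: GreenbergLNM1716, §1 (p. 60)] -/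
theorem resStrictHom_smul (htor : ∀ m : M, ∃ k : ℕ, p ^ k • m = 0)
    (hstab : ∀ m : M, IsOpen (MulAction.stabilizer (absoluteGaloisGroup K) m : Set (absoluteGaloisGroup K))) (hγ : κ.IsTopGenerator γ)
    (f : IwasawaAlgebra p) (x : D.X) :
    letI := strictDualModule κ R V j S₀ ε S₁ htor hstab hγ
    resStrictHom D S₁ (f • x) = f • resStrictHom D S₁ x := by
  letI := strictDualModule κ R V j S₀ ε S₁ htor hstab hγ
  exact IwasawaDual.dualHom_smul (AddMonoidHom.id _) Function.bijective_id D.toDual (strictSelmer κ M R V j S₀ ε S₁).subtype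
    (isLocNil_conjStrict_sub_one κ R V j S₀ ε S₁ htor hstab hγ) (isLocNil_conjSignedSat_sub_one κ R V j S₀ ε htor hstab hγ)
    (fun _ _ ↦ rfl) (fun g y ↦ toDual_smul_eq_smulFun D htor hstab hγ g y) (fun _ ↦ rfl) f x

/-- **`res` as a `Λ`-linear map `Dψ.X →ₗ[Λ] Y′`.** [cite: GreenbergLNM1716, §1 (p. 60)] -/
def resStrictLinearMap (htor : ∀ m : M, ∃ k : ℕ, p ^ k • m = 0)
    (hstab : ∀ m : M, IsOpen (MulAction.stabilizer (absoluteGaloisGroup K) m : Set (absoluteGaloisGroup K))) (hγ : κ.IsTopGenerator γ) :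
    letI := strictDualModule κ R V j S₀ ε S₁ htor hstab hγ
    D.X →ₗ[IwasawaAlgebra p] (strictSelmer κ M R V j S₀ ε S₁ →+ AddCircle (1 : ℚ)) :=
  letI := strictDualModule κ R V j S₀ ε S₁ htor hstab hγ
  { toFun := resStrictHom D S₁
    map_add' := map_add _
    map_smul' := fun f x ↦ resStrictHom_smul D S₁ htor hstab hγ f x }

/-- `resStrictLinearMap` is `resStrictHom` on elements. [folklore] -/
theorem resStrictLinearMap_apply (htor : ∀ m : M, ∃ k : ℕ, p ^ k • m = 0)
    (hstab : ∀ m : M, IsOpen (MulAction.stabilizer (absoluteGaloisGroup K) m : Set (absoluteGaloisGroup K))) (hγ : κ.IsTopGenerator γ) (x : D.X) :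
    resStrictLinearMap D S₁ htor hstab hγ x = resStrictHom D S₁ x :=
  rfl

/-- **`res` is SURJECTIVE**: every character of `Sel_str` extends to `Sel` (`ℚ/ℤ` is divisible, hence injective; the tree's
`IwasawaDual.exists_dualHom_eq_smul` with `n = 1`), and `toDual` is onto. [cite: Washington1997, §13.2] [folklore] -/
theorem resStrictHom_surjective : Function.Surjective (resStrictHom D S₁) := fun y ↦ by
  obtain ⟨x, hx⟩ := IwasawaDual.exists_dualHom_eq_smul (AddMonoidHom.id _) Function.bijective_id D.toDual D.bijective
    (strictSelmer κ M R V j S₀ ε S₁).subtype (n := 1) (fun s hs ↦ by rw [one_nsmul]; exact Subtype.ext hs) y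
  exact ⟨x, by rw [← one_nsmul y]; exact hx⟩

/-- **`res` KILLS `range gX`** (`gX = loc_v^∨`) as soon as `Sel_{str at Σ} ≤ Sel_{str,v} = ker loc_v` (`strictSelmer_le_strictAt` for the canonical restricted
action, `v ∈ Σ`): `res (gX q) s = DQ.toDual q (loc_v s) = 0`. [cite: Kobayashi2003, Thm. 7.3 i)] -/
theorem resStrictHom_gXHom {v : HeightOneSpectrum (𝓞 K)} [DistribMulAction (absoluteGaloisGroup (v.adicCompletion K)) M]
    {γv : absoluteGaloisGroup (v.adicCompletion K)} (DQ : LocalCondDualData κ M R V j ε v γv)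
    (hres : ∀ (σ : absoluteGaloisGroup (v.adicCompletion K)) (m : M), σ • m = resGalOfEmb (closureEmb (K := K) (v.adicCompletion K)) σ • m)
    (hvp : (p : 𝓞 K) ∈ v.asIdeal) (hle : strictSelmer κ M R V j S₀ ε S₁ ≤ strictAt κ M R V j S₀ ε v hres hvp) (q : DQ.X) :
    resStrictHom D S₁ (gXHom D DQ hres hvp q) = 0 := by
  ext s
  rw [resStrictHom_apply, toDual_gXHom_apply, AddMonoidHom.zero_apply, (AddMonoidHom.mem_ker).1 (hle s.2), map_zero]

end Restriction

/-! ## §4. ★ `λ(Y′) ≤ λ(coker gX)` -/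

section Lambda

variable {K : Type u} [Field K] [NumberField K] {p : ℕ} [Fact p.Prime] {κ : ZpExtension K p} {γ : absoluteGaloisGroup K}
  {M : Type u} [AddCommGroup M] [DistribMulAction (absoluteGaloisGroup K) M] [TopologicalSpace M] [DiscreteTopology M]
  {R : Type*} [Ring R] [Module R M]
  {V : WeierstrassCurve K} {j : V.geomPrimaryTorsion p →+ M} {S₀ : Set (HeightOneSpectrum (𝓞 K))} {ε : ℤˣ}
  (D : SignedTransportDualDataSat κ γ M R V j S₀ ε) (S₁ : Set (HeightOneSpectrum (𝓞 K)))
  {v : HeightOneSpectrum (𝓞 K)} [DistribMulAction (absoluteGaloisGroup (v.adicCompletion K)) M]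
  {γv : absoluteGaloisGroup (v.adicCompletion K)} (DQ : LocalCondDualData κ M R V j ε v γv)
  (hres : ∀ (σ : absoluteGaloisGroup (v.adicCompletion K)) (m : M), σ • m = resGalOfEmb (closureEmb (K := K) (v.adicCompletion K)) σ • m)
  (hvp : (p : 𝓞 K) ∈ v.asIdeal)

/-- The quotient of a torsion `Λ`-module by a submodule (over a bigger ring in a scalar tower) is torsion. [folklore] -/
theorem isTorsion_quotient_of_isTorsion {A : Type*} [Ring A] {X : Type*} [AddCommGroup X] [Module A X] [Module (IwasawaAlgebra p) X]
    [SMul (IwasawaAlgebra p) A] [IsScalarTower (IwasawaAlgebra p) A X] (N : Submodule A X) (hX : Module.IsTorsion (IwasawaAlgebra p) X) :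
    Module.IsTorsion (IwasawaAlgebra p) (X ⧸ N) := fun z ↦ by
  obtain ⟨x, rfl⟩ := Submodule.Quotient.mk_surjective N z
  obtain ⟨a, ha⟩ := @hX x
  refine ⟨a, ?_⟩
  change Submodule.Quotient.mk ((a : IwasawaAlgebra p) • x) = 0
  rw [show (a : IwasawaAlgebra p) • x = 0 from ha, Submodule.Quotient.mk_zero]

/-- ★ **`λ(Y′) ≤ λ(coker gX)`** (`Λ`-currency): for `Dψ.X` finitely generated torsion, the `Λ`-linear restriction `res` descends to a SURJECTION
`coker gX = Dψ.X ⧸ range gX ↠ Y′ = Hom(Sel_{str at Σ}, ℚ/ℤ)` (`res` kills `range gX`), so `λ(Y′) ≤ λ(Dψ.X ⧸ range gX)` (`lambdaInvariant_le_of_surjective'`).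
This is the elementary half `λ(Y′) ≤ λ(Y)` of the four-term bookkeeping of stub S3; the research halves are S3α `λ(H²₂/T₂) ≤ λ(Y′)` and S3β
`λ(Λ_𝒪/(E)) + λ(Y′) ≤ λ(Y) + λ(I.H/B′)`. [cite: Kobayashi2003, Thm. 7.3 i)] [cite: Washington1997, §13.2] -/
theorem lambdaInvariant_strictDual_le_coker (hle : strictSelmer κ M R V j S₀ ε S₁ ≤ strictAt κ M R V j S₀ ε v hres hvp)
    (htor : ∀ m : M, ∃ k : ℕ, p ^ k • m = 0)
    (hstabK : ∀ m : M, IsOpen (MulAction.stabilizer (absoluteGaloisGroup K) m : Set (absoluteGaloisGroup K)))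
    (hstab : ∀ m : M, IsOpen (MulAction.stabilizer (absoluteGaloisGroup (v.adicCompletion K)) m : Set (absoluteGaloisGroup (v.adicCompletion K))))
    (hγ : κ.IsTopGenerator γ) (hv : AcSigned.IsNonsplitIn κ v) (hγv : κ.IsTopGenerator (resGalOfEmb (closureEmb (K := K) (v.adicCompletion K)) γv))
    [Module.Finite (IwasawaAlgebra p) D.X] (hX : Module.IsTorsion (IwasawaAlgebra p) D.X) :
    letI := strictDualModule κ R V j S₀ ε S₁ htor hstabK hγ
    lambdaInvariant p (strictSelmer κ M R V j S₀ ε S₁ →+ AddCircle (1 : ℚ)) ≤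
      lambdaInvariant p (D.X ⧸ LinearMap.range (gXLinearMap D DQ hres hvp htor hstabK hstab hγ hv hγv)) := by
  letI := strictDualModule κ R V j S₀ ε S₁ htor hstabK hγ
  have hker : LinearMap.range (gXLinearMap D DQ hres hvp htor hstabK hstab hγ hv hγv) ≤ LinearMap.ker (resStrictLinearMap D S₁ htor hstabK hγ) := by
    rintro _ ⟨q, rfl⟩
    rw [LinearMap.mem_ker, resStrictLinearMap_apply, gXLinearMap_apply]
    exact resStrictHom_gXHom D S₁ DQ hres hvp hle q
  have hπ : Function.Surjective ((LinearMap.range (gXLinearMap D DQ hres hvp htor hstabK hstab hγ hv hγv)).liftQ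
      (resStrictLinearMap D S₁ htor hstabK hγ) hker) := fun y ↦ by
    obtain ⟨x, hx⟩ := resStrictHom_surjective D S₁ y
    exact ⟨Submodule.Quotient.mk x, hx⟩
  exact SmallImageRttCharRoad.lambdaInvariant_le_of_surjective' _ hπ
    (isTorsion_quotient_of_isTorsion (LinearMap.range (gXLinearMap D DQ hres hvp htor hstabK hstab hγ hv hγv)) hX)

end Lambda

/-! ## §5. ★ The same in the stub's `Λ_𝒪`-currency (`gXLinearMapO`, pinned `Λ_𝒪`-structures) -/

section LambdaO

variable {K : Type u} [Field K] [NumberField K] {p : ℕ} [Fact p.Prime] {κ : ZpExtension K p} {γ : absoluteGaloisGroup K}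
  (S : Set (PadicAlgCl p)) [FiniteDimensional ℚ_[p] (padicCoeffField S)]
  {M : Type u} [AddCommGroup M] [DistribMulAction (absoluteGaloisGroup K) M] [TopologicalSpace M] [DiscreteTopology M]
  [Module (padicCoeffIntegers S) M] [SMulCommClass (absoluteGaloisGroup K) (padicCoeffIntegers S) M]
  {V : WeierstrassCurve K} {j : V.geomPrimaryTorsion p →+ M} {S₀ : Set (HeightOneSpectrum (𝓞 K))} {ε : ℤˣ}
  (D : SignedTransportDualDataSat κ γ M (padicCoeffIntegers S) V j S₀ ε) (S₁ : Set (HeightOneSpectrum (𝓞 K)))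
  {v : HeightOneSpectrum (𝓞 K)} [DistribMulAction (absoluteGaloisGroup (v.adicCompletion K)) M]
  [SMulCommClass (absoluteGaloisGroup (v.adicCompletion K)) (padicCoeffIntegers S) M]
  {γv : absoluteGaloisGroup (v.adicCompletion K)} (DQ : LocalCondDualData κ M (padicCoeffIntegers S) V j ε v γv)
  (hres : ∀ (σ : absoluteGaloisGroup (v.adicCompletion K)) (m : M), σ • m = resGalOfEmb (closureEmb (K := K) (v.adicCompletion K)) σ • m)
  (hvp : (p : 𝓞 K) ∈ v.asIdeal)

/-- ★ **`λ(Y′) ≤ λ(Dψ.X ⧸ range gX)` in the `Λ_𝒪`-currency of stub S3** (`gX := gXLinearMapO …` for ANY pinned `Λ_𝒪`-structures `instX`, `instQ`, the quotient's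
`Λ`-structure through the scalar tower `Λ → Λ_𝒪`, exactly as in the line-file definition `CharRoadLambda`): `range gXLinearMapO` restricted to `Λ` IS
`range gXLinearMap` (same underlying map `gXHom`), `Submodule.Quotient.restrictScalarsEquiv`, and §4. [cite: Kobayashi2003, Thm. 7.3 i)] [cite: Washington1997, §13.2] -/
theorem lambdaInvariant_strictDual_le_coker_O (hle : strictSelmer κ M (padicCoeffIntegers S) V j S₀ ε S₁ ≤ strictAt κ M (padicCoeffIntegers S) V j S₀ ε v hres hvp)
    (instX : Module (IwasawaAlgebraO S) D.X) (instQ : Module (IwasawaAlgebraO S) DQ.X)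
    (hιX : ∀ (f : IwasawaAlgebra p) (x : D.X), (letI := instX; iwasawaToIwasawaO S f • x) = f • x)
    (hιQ : ∀ (f : IwasawaAlgebra p) (x : DQ.X), (letI := instQ; iwasawaToIwasawaO S f • x) = f • x)
    (hCX : ∀ (a : padicCoeffIntegers S) (x : D.X) (s : signedTransportSelmerInftySat κ M (padicCoeffIntegers S) V j S₀ ε),
      D.toDual (letI := instX; (PowerSeries.C a : IwasawaAlgebraO S) • x) s =
        D.toDual x ⟨GreenbergSelmer.scalarH1 κ.kerSubgroup M a s, scalarH1_mem_signedTransportSelmerInftySat κ M (padicCoeffIntegers S) V j S₀ ε a s.2⟩)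
    (hCQ : ∀ (a : padicCoeffIntegers S) (x : DQ.X) (c : localCondInftySat κ M (padicCoeffIntegers S) V j ε v),
      DQ.toDual (letI := instQ; (PowerSeries.C a : IwasawaAlgebraO S) • x) c = DQ.toDual x (scalarLocalSat κ M (padicCoeffIntegers S) V j ε v a c))
    (htor : ∀ m : M, ∃ k : ℕ, p ^ k • m = 0)
    (hstabK : ∀ m : M, IsOpen (MulAction.stabilizer (absoluteGaloisGroup K) m : Set (absoluteGaloisGroup K)))
    (hstab : ∀ m : M, IsOpen (MulAction.stabilizer (absoluteGaloisGroup (v.adicCompletion K)) m : Set (absoluteGaloisGroup (v.adicCompletion K))))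
    (hγ : κ.IsTopGenerator γ) (hv : AcSigned.IsNonsplitIn κ v) (hγv : κ.IsTopGenerator (resGalOfEmb (closureEmb (K := K) (v.adicCompletion K)) γv))
    [Module.Finite (IwasawaAlgebra p) D.X] (hX : Module.IsTorsion (IwasawaAlgebra p) D.X) :
    letI := instX; letI := instQ
    letI : Algebra (IwasawaAlgebra p) (IwasawaAlgebraO S) := (iwasawaToIwasawaO S).toAlgebra
    haveI : IsScalarTower (IwasawaAlgebra p) (IwasawaAlgebraO S) D.X :=
      SmallImageRttCharRoad.isScalarTower_iwasawaAlgebraO_of_smul_eq S (fun _ ↦ rfl) hιX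
    letI := strictDualModule κ (padicCoeffIntegers S) V j S₀ ε S₁ htor hstabK hγ
    lambdaInvariant p (strictSelmer κ M (padicCoeffIntegers S) V j S₀ ε S₁ →+ AddCircle (1 : ℚ)) ≤
      lambdaInvariant p (D.X ⧸ LinearMap.range (gXLinearMapO S D DQ hres hvp instX instQ hιX hιQ hCX hCQ htor hstabK hstab hγ hv hγv)) := by
  letI := instX; letI := instQ
  letI : Algebra (IwasawaAlgebra p) (IwasawaAlgebraO S) := (iwasawaToIwasawaO S).toAlgebra
  haveI : IsScalarTower (IwasawaAlgebra p) (IwasawaAlgebraO S) D.X :=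
    SmallImageRttCharRoad.isScalarTower_iwasawaAlgebraO_of_smul_eq S (fun _ ↦ rfl) hιX
  letI := strictDualModule κ (padicCoeffIntegers S) V j S₀ ε S₁ htor hstabK hγ
  have heq : (LinearMap.range (gXLinearMapO S D DQ hres hvp instX instQ hιX hιQ hCX hCQ htor hstabK hstab hγ hv hγv)).restrictScalars (IwasawaAlgebra p) =
      LinearMap.range (gXLinearMap D DQ hres hvp htor hstabK hstab hγ hv hγv) := by
    ext x
    simp only [Submodule.restrictScalars_mem, LinearMap.mem_range, gXLinearMapO_apply, gXLinearMap_apply]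
  rw [lambdaInvariant_eq_of_linearEquiv ((Submodule.Quotient.restrictScalarsEquiv (IwasawaAlgebra p)
    (LinearMap.range (gXLinearMapO S D DQ hres hvp instX instQ hιX hιQ hCX hCQ htor hstabK hstab hγ hv hγv))).symm.trans (Submodule.quotEquivOfEq _ _ heq))]
  exact lambdaInvariant_strictDual_le_coker D S₁ DQ hres hvp hle htor hstabK hstab hγ hv hγv hX

end LambdaO

end Summit.BirchSwinnertonDyer.BirchSwinnertonDyer.Theorems.SmallImageRttD2Seq

end
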